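import Literature.Analysis.FunctionSpaces.FourierSobolevNormProofs
import Literature.Analysis.FunctionSpaces.Complexify
import Literature.Analysis.UnboundedOperators.HeatSemigroupLpProofs
import Literature.Analysis.UnboundedOperators.HeatKernelSymbol
import Literature.Analysis.UnboundedOperators.HeatKernelGaussianData
import HarnessLib

/-!
# Tools for the Fourier-side `Ḣ^s ∩ L²` seminorm: triangle inequality, interpolation between
# orders, and the `Ḣ^s` smoothing of the heat semigroup on `L²`

Analysis/FunctionSpaces support file (everything **proved**, no definitions, no named facts) for
the tree's homogeneous Sobolev seminorm `eHomSobolevSeminorm s f = (∫ ‖ξ‖^{2s} ‖𝓕f(ξ)‖² dξ)^{1/2}`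
of an `L²` function (`FourierSobolevNorm.lean`, Bahouri–Chemin–Danchin 2011, Def. 1.31), its
function-level wrapper `Function.eHomSobolevSeminorm` (junk `∞` off `L²`) and the membership
predicate `MemHomSobolev s f` (`f ∈ Ḣ^s ∩ L²`). Written for the persistence-of-regularity
argument of `Literature/Analysis/FluidPDE/RusinSverakRhoMaxPureLe.lean` (the Kato and the
Fujita–Kato solutions of Navier–Stokes coincide), which needs exactly three facts about these
seminorms, all standard:

* `§ LpLevel`, `§ FunctionLevel`: the seminorm is the `L²(‖ξ‖^{2s}dξ)` norm of `𝓕f`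
  (`eLpNorm_fourier_homSobolevMeasure`), hence subadditive (`eHomSobolevSeminorm_add_le`,
  `Function.eHomSobolevSeminorm_add_le`, …), and at order `0` it is the `L²` norm (Plancherel,
  Mathlib `Lp.norm_fourier_eq`); `MemHomSobolev s f ↔ f ∈ L² ∧ ‖f‖_{Ḣ^s} < ∞`
  (`memHomSobolev_iff`), whence `MemHomSobolev.add/neg/sub`.
* `§ Interpolation`: **interpolation between orders** (BCD 2011, Prop. 1.32:
  `‖u‖_{Ḣ^{s}} ≤ ‖u‖_{Ḣ^{s₀}}^{1-θ} ‖u‖_{Ḣ^{s₁}}^{θ}`, `s = (1-θ)s₀ + θ s₁`) — Hölder's inequality on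
  the Fourier side (Mathlib `ENNReal.lintegral_mul_le_Lp_mul_Lq`); in particular
  `Ḣ^{s₁} ∩ L² ⊆ Ḣ^{s} ∩ L²` for `0 ≤ s ≤ s₁` (`MemHomSobolev.of_le`).
* `§ Heat`: **the heat semigroup on `L²` is the Fourier multiplier `e^{-(2π)²σ|ξ|²}`**
  (`fourier_toLp_heatExtension_ae_eq`: for `f ∈ L²`, `𝓕(e^{σΔ}f) = Ĝ_σ · 𝓕f` a.e.; Stein–Weiss,
  Ch. I Thm. 1.18 and §3 — assembled from the tree's `heatSemigroup_toTemperedDistribution_Lp_holds`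
  and Mathlib's `Lp.fourier_toTemperedDistribution_eq`, `Lp.toTemperedDistribution_smul_eq`,
  `Lp.ker_toTemperedDistributionCLM_eq_bot`), whence the contraction
  `‖e^{σΔ}f‖_{Ḣ^s} ≤ ‖f‖_{Ḣ^s}` and the **smoothing estimate**
  `‖e^{σΔ}f‖_{Ḣ^s} ≤ (8π²σ)^{-s/2} ‖f‖_{L²}`, `0 ≤ s ≤ 1` (BCD 2011, Lemma 2.4 / the elementary
  bound `x^s e^{-x} ≤ 1`), with `e^{σΔ}f ∈ Ḣ^s ∩ L²` (`memHomSobolev_heatExtension`); and the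
  commutation of the (real-kernel) heat extension with the complexification of real vector fields
  (`EuclideanSpace.complexify_comp_heatExtension`).

## Mathlib / tree search

Tree (`lean search 'eHomSobolevSeminorm|MemHomSobolev'`): only `Function.eHomSobolevSeminorm_congr_ae`,
`MemHomSobolev.congr_ae`, `MemHomSobolev.const_smul`, `eHomSobolevSeminorm_const_smul` (on `ℝ³`),
`eLpNorm_fourier_homSobolevMeasure`, `HomSobolev.enorm_ofFun` existed; no triangle inequality, no
interpolation, no heat smoothing in `Ḣ^s` (`lean search 'MemHomSobolev.*heat|heat.*HomSobolev'`:
nothing). Mathlib has no homogeneous Sobolev spaces. Used: `ENNReal.lintegral_mul_le_Lp_mul_Lq`,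
`Lp.norm_fourier_eq`, `Lp.coeFn_lpSMul`, `LinearIsometry.integral_comp_comm`,
`withDensity_absolutelyContinuous` (as in `FluidPDE.homSobolevMeasure_absolutelyContinuous_volume`,
not imported: it lives above this file), `Real.add_one_le_exp`.

## References

* H. Bahouri, J.-Y. Chemin, R. Danchin, *Fourier Analysis and Nonlinear Partial Differential
  Equations*, Springer 2011, Def. 1.31, Prop. 1.32 (interpolation), Lemma 2.4 (heat smoothing).
  [BahouriCheminDanchin2011]
* E. M. Stein, G. Weiss, *Introduction to Fourier Analysis on Euclidean Spaces*, Princeton 1971,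
  Ch. I, Thm. 1.18 and §3 (the Gauss–Weierstrass semigroup as a Fourier multiplier). [SteinWeiss1971]
-/

noncomputable section

open MeasureTheory ENNReal FourierTransform
open scoped SchwartzMap NNReal

namespace Literature.Analysis.FunctionSpaces

variable {E F : Type*} [NormedAddCommGroup E] [InnerProductSpace ℝ E] [FiniteDimensional ℝ E]
  [MeasurableSpace E] [BorelSpace E] [NormedAddCommGroup F] [InnerProductSpace ℂ F]
  [CompleteSpace F]

/-! ### The seminorm of `L²` classes: weighted `L²` norm of `𝓕f`, subadditivity, order `0` -/

section LpLevel

/-- `‖f‖_{Ḣ^s} = ‖𝓕f‖_{L²(‖ξ‖^{2s}dξ)}` (restatement of `eLpNorm_fourier_homSobolevMeasure`;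
Bahouri–Chemin–Danchin 2011, Def. 1.31). [cite: BahouriCheminDanchin2011, Def. 1.31] -/
theorem eHomSobolevSeminorm_eq_eLpNorm_fourier (s : ℝ) (f : Lp F 2 (volume : Measure E)) :
    eHomSobolevSeminorm s f =
      eLpNorm ((𝓕 f : Lp F 2 (volume : Measure E)) : E → F) 2 (homSobolevMeasure E s) :=
  (eLpNorm_fourier_homSobolevMeasure s f).symm

/-- **Triangle inequality** for the `Ḣ^s` seminorm of `L²` classes:
`‖f + g‖_{Ḣ^s} ≤ ‖f‖_{Ḣ^s} + ‖g‖_{Ḣ^s}` (`𝓕` is additive and the seminorm is an `L²` norm of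
`𝓕f`; Bahouri–Chemin–Danchin 2011, Def. 1.31 / Prop. 1.34). [cite: BahouriCheminDanchin2011, Def. 1.31] -/
theorem eHomSobolevSeminorm_add_le (s : ℝ) (f g : Lp F 2 (volume : Measure E)) :
    eHomSobolevSeminorm s (f + g) ≤ eHomSobolevSeminorm s f + eHomSobolevSeminorm s g := by
  simp only [eHomSobolevSeminorm_eq_eLpNorm_fourier]
  have hac : homSobolevMeasure E s ≪ (volume : Measure E) := withDensity_absolutelyContinuous _ _
  have hadd : ((𝓕 (f + g) : Lp F 2 (volume : Measure E)) : E → F) =ᵐ[homSobolevMeasure E s]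
      ((𝓕 f : Lp F 2 (volume : Measure E)) : E → F) +
        ((𝓕 g : Lp F 2 (volume : Measure E)) : E → F) := by
    rw [FourierAdd.fourier_add]
    exact hac.ae_eq (Lp.coeFn_add _ _)
  rw [eLpNorm_congr_ae hadd]
  exact eLpNorm_add_le ((Lp.aestronglyMeasurable _).mono_ac hac)
    ((Lp.aestronglyMeasurable _).mono_ac hac) one_le_two

/-- `‖-f‖_{Ḣ^s} = ‖f‖_{Ḣ^s}`. [folklore] -/
theorem eHomSobolevSeminorm_neg (s : ℝ) (f : Lp F 2 (volume : Measure E)) :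
    eHomSobolevSeminorm s (-f) = eHomSobolevSeminorm s f := by
  simp only [eHomSobolevSeminorm_eq_eLpNorm_fourier]
  have hac : homSobolevMeasure E s ≪ (volume : Measure E) := withDensity_absolutelyContinuous _ _
  have hneg : ((𝓕 (-f) : Lp F 2 (volume : Measure E)) : E → F) =ᵐ[homSobolevMeasure E s]
      -((𝓕 f : Lp F 2 (volume : Measure E)) : E → F) := by
    rw [FourierTransform.fourier_neg]
    exact hac.ae_eq (Lp.coeFn_neg _)
  rw [eLpNorm_congr_ae hneg, eLpNorm_neg]

/-- `‖f - g‖_{Ḣ^s} ≤ ‖f‖_{Ḣ^s} + ‖g‖_{Ḣ^s}`. [folklore] -/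
theorem eHomSobolevSeminorm_sub_le (s : ℝ) (f g : Lp F 2 (volume : Measure E)) :
    eHomSobolevSeminorm s (f - g) ≤ eHomSobolevSeminorm s f + eHomSobolevSeminorm s g := by
  rw [sub_eq_add_neg]
  exact (eHomSobolevSeminorm_add_le s f (-g)).trans (by rw [eHomSobolevSeminorm_neg])

/-- **Order zero is the `L²` norm** (Plancherel): `‖f‖_{Ḣ^0} = ‖𝓕f‖_{L²} = ‖f‖_{L²}`
(Mathlib `Lp.norm_fourier_eq`). [folklore] -/
theorem eHomSobolevSeminorm_zero_eq_eLpNorm (f : Lp F 2 (volume : Measure E)) :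
    eHomSobolevSeminorm 0 f = eLpNorm (f : E → F) 2 (volume : Measure E) := by
  have h1 : eHomSobolevSeminorm 0 f =
      eLpNorm ((𝓕 f : Lp F 2 (volume : Measure E)) : E → F) 2 (volume : Measure E) := by
    rw [eHomSobolevSeminorm, eLpNorm_eq_lintegral_rpow_enorm_toReal two_ne_zero ENNReal.ofNat_ne_top]
    simp only [mul_zero, ENNReal.rpow_zero, one_mul, ENNReal.toReal_ofNat, ENNReal.rpow_ofNat,
      one_div]
  rw [h1, ← Lp.enorm_def, ← Lp.enorm_def]
  rw [← ofReal_norm, ← ofReal_norm, Lp.norm_fourier_eq]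

end LpLevel

/-! ### Interpolation between orders -/

section Interpolation

/-- Pointwise splitting of the `Ḣ^s` weight: for `0 ≤ s₀`, `s₀ < s₁`, `s₀ ≤ s ≤ s₁` and
`α = (s₁ - s)/(s₁ - s₀)`, `β = (s - s₀)/(s₁ - s₀)`,
`‖ξ‖^{2s} G² = (‖ξ‖^{2s₀} G²)^α (‖ξ‖^{2s₁} G²)^β` in `ℝ≥0∞`. [folklore] -/
theorem hom_weight_split {s₀ s₁ s : ℝ} (hs₀ : 0 ≤ s₀) (h₀ : s₀ ≤ s) (h₁ : s ≤ s₁) (h : s₀ < s₁)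
    (w G : ℝ≥0∞) :
    w ^ (2 * s) * G ^ (2 : ℕ) =
      (w ^ (2 * s₀) * G ^ (2 : ℕ)) ^ ((s₁ - s) / (s₁ - s₀)) *
        (w ^ (2 * s₁) * G ^ (2 : ℕ)) ^ ((s - s₀) / (s₁ - s₀)) := by
  set α : ℝ := (s₁ - s) / (s₁ - s₀) with hα
  set β : ℝ := (s - s₀) / (s₁ - s₀) with hβ
  have hd : 0 < s₁ - s₀ := sub_pos.2 h
  have hα0 : 0 ≤ α := div_nonneg (sub_nonneg.2 h₁) hd.le
  have hβ0 : 0 ≤ β := div_nonneg (sub_nonneg.2 h₀) hd.le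
  have hαβ : α + β = 1 := by
    rw [hα, hβ, ← add_div, show s₁ - s + (s - s₀) = s₁ - s₀ by ring, div_self hd.ne']
  have hexp : 2 * s₀ * α + 2 * s₁ * β = 2 * s := by
    rw [hα, hβ]
    field_simp
    ring
  rw [ENNReal.mul_rpow_of_nonneg _ _ hα0, ENNReal.mul_rpow_of_nonneg _ _ hβ0, ← ENNReal.rpow_mul,
    ← ENNReal.rpow_mul, ← ENNReal.rpow_natCast, ← ENNReal.rpow_mul, ← ENNReal.rpow_mul]
  have hG : (G ^ ((2 : ℕ) : ℝ)) = G ^ (((2 : ℕ) : ℝ) * α) * G ^ (((2 : ℕ) : ℝ) * β) := by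
    rw [← ENNReal.rpow_add_of_nonneg _ _ (by positivity) (by positivity), ← mul_add, hαβ, mul_one]
  have hw : w ^ (2 * s) = w ^ (2 * s₀ * α) * w ^ (2 * s₁ * β) := by
    rw [← ENNReal.rpow_add_of_nonneg _ _ (by positivity) (by nlinarith), hexp]
  rw [hG, hw]
  ring

/-- **Interpolation between orders for the `Ḣ^s` seminorms of an `L²` class**
(Bahouri–Chemin–Danchin 2011, Prop. 1.32): for `0 ≤ s₀ ≤ s ≤ s₁`, `s₀ < s₁`,
`‖f‖_{Ḣ^s} ≤ ‖f‖_{Ḣ^{s₀}}^{(s₁-s)/(s₁-s₀)} ‖f‖_{Ḣ^{s₁}}^{(s-s₀)/(s₁-s₀)}` — Hölder's inequality with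
exponents `(s₁-s₀)/(s₁-s)`, `(s₁-s₀)/(s-s₀)` applied to the splitting of the weight
`‖ξ‖^{2s}‖𝓕f‖² = (‖ξ‖^{2s₀}‖𝓕f‖²)^α (‖ξ‖^{2s₁}‖𝓕f‖²)^β`. [cite: BahouriCheminDanchin2011, Prop. 1.32] -/
theorem eHomSobolevSeminorm_interpolate {s₀ s₁ s : ℝ} (hs₀ : 0 ≤ s₀) (h₀ : s₀ ≤ s) (h₁ : s ≤ s₁)
    (h : s₀ < s₁) (f : Lp F 2 (volume : Measure E)) :
    eHomSobolevSeminorm s f ≤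
      eHomSobolevSeminorm s₀ f ^ ((s₁ - s) / (s₁ - s₀)) *
        eHomSobolevSeminorm s₁ f ^ ((s - s₀) / (s₁ - s₀)) := by
  set α : ℝ := (s₁ - s) / (s₁ - s₀) with hα
  set β : ℝ := (s - s₀) / (s₁ - s₀) with hβ
  have hd : 0 < s₁ - s₀ := sub_pos.2 h
  have hα0 : 0 ≤ α := div_nonneg (sub_nonneg.2 h₁) hd.le
  have hβ0 : 0 ≤ β := div_nonneg (sub_nonneg.2 h₀) hd.le
  set G : E → F := ((𝓕 f : Lp F 2 (volume : Measure E)) : E → F) with hGdef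
  have hGm : AEMeasurable (fun ξ => ‖G ξ‖ₑ) volume := (Lp.aestronglyMeasurable _).enorm
  -- the three integrals
  set I : ℝ → ℝ≥0∞ := fun r => ∫⁻ ξ, ‖ξ‖ₑ ^ (2 * r) * ‖G ξ‖ₑ ^ (2 : ℕ) with hI
  have hsemi : ∀ r, eHomSobolevSeminorm r f = I r ^ (1 / 2 : ℝ) := fun r => rfl
  -- degenerate cases `s = s₀`, `s = s₁`
  rcases h₀.eq_or_lt with hss₀ | hss₀
  · subst hss₀
    have hα1 : α = 1 := by rw [hα, div_self hd.ne']
    have hβ0' : β = 0 := by rw [hβ, sub_self, zero_div]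
    rw [hα1, hβ0', ENNReal.rpow_one, ENNReal.rpow_zero, mul_one]
  rcases h₁.eq_or_lt with hss₁ | hss₁
  · subst hss₁
    have hα0' : α = 0 := by rw [hα, sub_self, zero_div]
    have hβ1 : β = 1 := by rw [hβ, div_self hd.ne']
    rw [hα0', hβ1, ENNReal.rpow_one, ENNReal.rpow_zero, one_mul]
  -- Hölder with `p = 1/α`, `q = 1/β`
  have hαpos : 0 < α := div_pos (sub_pos.2 hss₁) hd
  have hβpos : 0 < β := div_pos (sub_pos.2 hss₀) hd
  have hαβ : α + β = 1 := by
    rw [hα, hβ, ← add_div, show s₁ - s + (s - s₀) = s₁ - s₀ by ring, div_self hd.ne']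
  have hpq : (1 / α).HolderConjugate (1 / β) := Real.holderConjugate_one_div hαpos hβpos hαβ
  have hmeas₀ : AEMeasurable (fun ξ : E => (‖ξ‖ₑ ^ (2 * s₀) * ‖G ξ‖ₑ ^ (2 : ℕ)) ^ α) volume :=
    ((measurable_enorm.aemeasurable.pow_const _).mul (hGm.pow_const _)).pow_const _
  have hmeas₁ : AEMeasurable (fun ξ : E => (‖ξ‖ₑ ^ (2 * s₁) * ‖G ξ‖ₑ ^ (2 : ℕ)) ^ β) volume :=
    ((measurable_enorm.aemeasurable.pow_const _).mul (hGm.pow_const _)).pow_const _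
  have hH := ENNReal.lintegral_mul_le_Lp_mul_Lq (volume : Measure E) hpq hmeas₀ hmeas₁
  have hsplit : I s = ∫⁻ ξ, ((fun ξ : E => (‖ξ‖ₑ ^ (2 * s₀) * ‖G ξ‖ₑ ^ (2 : ℕ)) ^ α) *
      fun ξ : E => (‖ξ‖ₑ ^ (2 * s₁) * ‖G ξ‖ₑ ^ (2 : ℕ)) ^ β) ξ := by
    refine lintegral_congr fun ξ => ?_
    simp only [Pi.mul_apply]
    exact hom_weight_split hs₀ h₀ h₁ h _ _
  have hI₀ : ∫⁻ ξ, ((‖ξ‖ₑ ^ (2 * s₀) * ‖G ξ‖ₑ ^ (2 : ℕ)) ^ α) ^ (1 / α) = I s₀ := by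
    refine lintegral_congr fun ξ => ?_
    rw [← ENNReal.rpow_mul, mul_one_div_cancel hαpos.ne', ENNReal.rpow_one]
  have hI₁ : ∫⁻ ξ, ((‖ξ‖ₑ ^ (2 * s₁) * ‖G ξ‖ₑ ^ (2 : ℕ)) ^ β) ^ (1 / β) = I s₁ := by
    refine lintegral_congr fun ξ => ?_
    rw [← ENNReal.rpow_mul, mul_one_div_cancel hβpos.ne', ENNReal.rpow_one]
  rw [hI₀, hI₁, ← hsplit, one_div_one_div, one_div_one_div] at hH
  -- take square roots
  rw [hsemi s, hsemi s₀, hsemi s₁]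
  calc I s ^ (1 / 2 : ℝ) ≤ (I s₀ ^ α * I s₁ ^ β) ^ (1 / 2 : ℝ) := by gcongr
    _ = (I s₀ ^ (1 / 2 : ℝ)) ^ α * (I s₁ ^ (1 / 2 : ℝ)) ^ β := by
        rw [ENNReal.mul_rpow_of_nonneg _ _ (by norm_num), ← ENNReal.rpow_mul, ← ENNReal.rpow_mul,
          ← ENNReal.rpow_mul, ← ENNReal.rpow_mul, mul_comm α, mul_comm β]

end Interpolation

/-! ### Function level: `Function.eHomSobolevSeminorm` and `MemHomSobolev` -/

section FunctionLevel

/-- Unfolding of the function-level seminorm on `L²` functions: for `f ∈ L²`,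
`Function.eHomSobolevSeminorm s f = eHomSobolevSeminorm s (hf.toLp f)`. [folklore] -/
theorem _root_.Function.eHomSobolevSeminorm_of_memLp {s : ℝ} {f : E → F}
    (hf : MemLp f 2 (volume : Measure E)) :
    Function.eHomSobolevSeminorm s f = eHomSobolevSeminorm s (hf.toLp f) := by
  rw [Function.eHomSobolevSeminorm, dif_pos hf]

/-- Off `L²` the function-level seminorm takes its junk value `∞`. [folklore] -/
theorem _root_.Function.eHomSobolevSeminorm_of_not_memLp {s : ℝ} {f : E → F}
    (hf : ¬ MemLp f 2 (volume : Measure E)) :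
    Function.eHomSobolevSeminorm s f = ∞ := by
  rw [Function.eHomSobolevSeminorm, dif_neg hf]

/-- **`f ∈ Ḣ^s ∩ L²` iff `f ∈ L²` and `‖f‖_{Ḣ^s} < ∞`** (Bahouri–Chemin–Danchin 2011, Def. 1.31:
membership is finiteness of the weighted `L²` norm of `𝓕f`, which is a.e. strongly measurable
for `‖ξ‖^{2s}dξ ≪ dξ`). [cite: BahouriCheminDanchin2011, Def. 1.31] -/
theorem memHomSobolev_iff {s : ℝ} {f : E → F} :
    MemHomSobolev s f ↔
      MemLp f 2 (volume : Measure E) ∧ Function.eHomSobolevSeminorm s f < ∞ := by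
  constructor
  · rintro ⟨hf, hF⟩
    refine ⟨hf, ?_⟩
    rw [Function.eHomSobolevSeminorm_of_memLp hf, eHomSobolevSeminorm_eq_eLpNorm_fourier]
    exact hF.eLpNorm_lt_top
  · rintro ⟨hf, hfin⟩
    refine ⟨hf, (Lp.aestronglyMeasurable _).mono_ac (withDensity_absolutelyContinuous _ _), ?_⟩
    rwa [← eHomSobolevSeminorm_eq_eLpNorm_fourier, ← Function.eHomSobolevSeminorm_of_memLp hf]

/-- An `Ḣ^s ∩ L²` function is in `L²`. [folklore] -/
theorem MemHomSobolev.memLp {s : ℝ} {f : E → F} (hf : MemHomSobolev s f) :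
    MemLp f 2 (volume : Measure E) :=
  (memHomSobolev_iff.1 hf).1

/-- An `Ḣ^s ∩ L²` function has finite `Ḣ^s` seminorm. [folklore] -/
theorem MemHomSobolev.eHomSobolevSeminorm_lt_top {s : ℝ} {f : E → F} (hf : MemHomSobolev s f) :
    Function.eHomSobolevSeminorm s f < ∞ :=
  (memHomSobolev_iff.1 hf).2

/-- **Triangle inequality, function level**: `‖f + g‖_{Ḣ^s} ≤ ‖f‖_{Ḣ^s} + ‖g‖_{Ḣ^s}` for all
`f, g : E → F` (if one of them is not in `L²` the right-hand side is `∞`). [folklore] -/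
theorem _root_.Function.eHomSobolevSeminorm_add_le (s : ℝ) (f g : E → F) :
    Function.eHomSobolevSeminorm s (f + g) ≤
      Function.eHomSobolevSeminorm s f + Function.eHomSobolevSeminorm s g := by
  by_cases hf : MemLp f 2 (volume : Measure E)
  · by_cases hg : MemLp g 2 (volume : Measure E)
    · rw [Function.eHomSobolevSeminorm_of_memLp hf, Function.eHomSobolevSeminorm_of_memLp hg,
        Function.eHomSobolevSeminorm_of_memLp (hf.add hg), MemLp.toLp_add hf hg]
      exact Literature.Analysis.FunctionSpaces.eHomSobolevSeminorm_add_le s _ _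
    · rw [Function.eHomSobolevSeminorm_of_not_memLp hg, add_top]
      exact le_top
  · rw [Function.eHomSobolevSeminorm_of_not_memLp hf, top_add]
    exact le_top

/-- `‖-f‖_{Ḣ^s} = ‖f‖_{Ḣ^s}`, function level. [folklore] -/
theorem _root_.Function.eHomSobolevSeminorm_neg (s : ℝ) (f : E → F) :
    Function.eHomSobolevSeminorm s (-f) = Function.eHomSobolevSeminorm s f := by
  by_cases hf : MemLp f 2 (volume : Measure E)
  · rw [Function.eHomSobolevSeminorm_of_memLp hf, Function.eHomSobolevSeminorm_of_memLp hf.neg,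
      MemLp.toLp_neg hf, Literature.Analysis.FunctionSpaces.eHomSobolevSeminorm_neg]
  · have hnf : ¬ MemLp (-f) 2 (volume : Measure E) := fun h => hf (by simpa using h.neg)
    rw [Function.eHomSobolevSeminorm_of_not_memLp hf, Function.eHomSobolevSeminorm_of_not_memLp hnf]

/-- **Triangle inequality for differences, function level**:
`‖f - g‖_{Ḣ^s} ≤ ‖f‖_{Ḣ^s} + ‖g‖_{Ḣ^s}`. [folklore] -/
theorem _root_.Function.eHomSobolevSeminorm_sub_le (s : ℝ) (f g : E → F) :
    Function.eHomSobolevSeminorm s (f - g) ≤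
      Function.eHomSobolevSeminorm s f + Function.eHomSobolevSeminorm s g := by
  rw [sub_eq_add_neg]
  exact (Function.eHomSobolevSeminorm_add_le s f (-g)).trans
    (by rw [Function.eHomSobolevSeminorm_neg])

/-- **Order zero is the `L²` norm, function level**: `‖f‖_{Ḣ^0} = ‖f‖_{L²}` for `f ∈ L²`.
[folklore] -/
theorem _root_.Function.eHomSobolevSeminorm_zero_eq_eLpNorm {f : E → F}
    (hf : MemLp f 2 (volume : Measure E)) :
    Function.eHomSobolevSeminorm 0 f = eLpNorm f 2 (volume : Measure E) := by
  rw [Function.eHomSobolevSeminorm_of_memLp hf,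
    Literature.Analysis.FunctionSpaces.eHomSobolevSeminorm_zero_eq_eLpNorm,
    eLpNorm_congr_ae hf.coeFn_toLp]

/-- **Interpolation between orders, function level** (Bahouri–Chemin–Danchin 2011, Prop. 1.32):
for `0 ≤ s₀ ≤ s ≤ s₁`, `s₀ < s₁` and any `f : E → F`,
`‖f‖_{Ḣ^s} ≤ ‖f‖_{Ḣ^{s₀}}^{(s₁-s)/(s₁-s₀)} ‖f‖_{Ḣ^{s₁}}^{(s-s₀)/(s₁-s₀)}`.
[cite: BahouriCheminDanchin2011, Prop. 1.32] -/
theorem _root_.Function.eHomSobolevSeminorm_interpolate {s₀ s₁ s : ℝ} (hs₀ : 0 ≤ s₀) (h₀ : s₀ ≤ s)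
    (h₁ : s ≤ s₁) (h : s₀ < s₁) (f : E → F) :
    Function.eHomSobolevSeminorm s f ≤
      Function.eHomSobolevSeminorm s₀ f ^ ((s₁ - s) / (s₁ - s₀)) *
        Function.eHomSobolevSeminorm s₁ f ^ ((s - s₀) / (s₁ - s₀)) := by
  by_cases hf : MemLp f 2 (volume : Measure E)
  · simp only [Function.eHomSobolevSeminorm_of_memLp hf]
    exact Literature.Analysis.FunctionSpaces.eHomSobolevSeminorm_interpolate hs₀ h₀ h₁ h _
  · simp only [Function.eHomSobolevSeminorm_of_not_memLp hf]
    rcases h₀.eq_or_lt with hss₀ | hss₀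
    · subst hss₀
      rw [div_self (sub_pos.2 h).ne', ENNReal.top_rpow_of_pos one_pos, top_mul]
      exact (ENNReal.rpow_pos_of_nonneg (by simp) (div_nonneg (sub_nonneg.2 le_rfl)
        (sub_pos.2 h).le)).ne'
    · rw [ENNReal.top_rpow_of_pos (div_pos (sub_pos.2 hss₀) (sub_pos.2 h)), mul_top]
      exact (ENNReal.rpow_pos_of_nonneg (by simp) (div_nonneg (sub_nonneg.2 h₁)
        (sub_pos.2 h).le)).ne'

/-- **The interpolation inequality with `s₀ = 0`**: for `0 ≤ s ≤ s₁`, `0 < s₁` and `f ∈ L²`,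
`‖f‖_{Ḣ^s} ≤ ‖f‖_{L²}^{1 - s/s₁} ‖f‖_{Ḣ^{s₁}}^{s/s₁}` (Bahouri–Chemin–Danchin 2011, Prop. 1.32
with Plancherel at order `0`). [cite: BahouriCheminDanchin2011, Prop. 1.32] -/
theorem _root_.Function.eHomSobolevSeminorm_le_eLpNorm_rpow_mul_rpow {s₁ s : ℝ} (h₀ : 0 ≤ s)
    (h₁ : s ≤ s₁) (h : 0 < s₁) {f : E → F} (hf : MemLp f 2 (volume : Measure E)) :
    Function.eHomSobolevSeminorm s f ≤
      eLpNorm f 2 (volume : Measure E) ^ ((s₁ - s) / s₁) *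
        Function.eHomSobolevSeminorm s₁ f ^ (s / s₁) := by
  have := Function.eHomSobolevSeminorm_interpolate le_rfl h₀ h₁ h f
  rwa [Function.eHomSobolevSeminorm_zero_eq_eLpNorm hf, sub_zero, sub_zero] at this

/-- `Ḣ^s ∩ L²` is closed under addition. [folklore] -/
theorem MemHomSobolev.add {s : ℝ} {f g : E → F} (hf : MemHomSobolev s f) (hg : MemHomSobolev s g) :
    MemHomSobolev s (f + g) := by
  rw [memHomSobolev_iff] at hf hg ⊢
  exact ⟨hf.1.add hg.1, (Function.eHomSobolevSeminorm_add_le s f g).trans_lt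
    (ENNReal.add_lt_top.2 ⟨hf.2, hg.2⟩)⟩

/-- `Ḣ^s ∩ L²` is closed under negation. [folklore] -/
theorem MemHomSobolev.neg {s : ℝ} {f : E → F} (hf : MemHomSobolev s f) : MemHomSobolev s (-f) := by
  rw [memHomSobolev_iff] at hf ⊢
  exact ⟨hf.1.neg, by rw [Function.eHomSobolevSeminorm_neg]; exact hf.2⟩

/-- `Ḣ^s ∩ L²` is closed under subtraction. [folklore] -/
theorem MemHomSobolev.sub {s : ℝ} {f g : E → F} (hf : MemHomSobolev s f) (hg : MemHomSobolev s g) :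
    MemHomSobolev s (f - g) := by
  rw [sub_eq_add_neg]
  exact hf.add hg.neg

/-- **`Ḣ^{s₁} ∩ L² ⊆ Ḣ^s ∩ L²` for `0 ≤ s ≤ s₁`** (interpolation with the `L²` norm;
Bahouri–Chemin–Danchin 2011, Prop. 1.32). [cite: BahouriCheminDanchin2011, Prop. 1.32] -/
theorem MemHomSobolev.of_le {s₁ s : ℝ} {f : E → F} (hf : MemHomSobolev s₁ f) (h₀ : 0 ≤ s)
    (h₁ : s ≤ s₁) : MemHomSobolev s f := by
  rcases h₁.eq_or_lt with h | h
  · exact h ▸ hf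
  have hs₁ : 0 < s₁ := h₀.trans_lt h
  rw [memHomSobolev_iff] at hf ⊢
  refine ⟨hf.1, (Function.eHomSobolevSeminorm_le_eLpNorm_rpow_mul_rpow h₀ h₁ hs₁ hf.1).trans_lt ?_⟩
  exact ENNReal.mul_lt_top
    (ENNReal.rpow_lt_top_of_nonneg (div_nonneg (sub_nonneg.2 h₁) hs₁.le) hf.1.eLpNorm_ne_top)
    (ENNReal.rpow_lt_top_of_nonneg (div_nonneg h₀ hs₁.le) hf.2.ne)

end FunctionLevel

/-! ### The heat semigroup on `L²`: Fourier multiplier, `Ḣ^s` contraction and smoothing -/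

section Heat

open UnboundedOperators (heatExtension heatSymbol)
open Filter

/-- `f ∈ L²` implies `e^{σΔ}f ∈ L²` for `σ > 0` (the tree's `memLp_heatExtension_holds`; Young's
inequality with the probability kernel `G_σ`). [folklore] -/
theorem memLp_two_heatExtension {f : E → F} (hf : MemLp f 2 (volume : Measure E)) {σ : ℝ}
    (hσ : 0 < σ) : MemLp (heatExtension f σ) 2 (volume : Measure E) :=
  UnboundedOperators.memLp_heatExtension_holds hf one_le_two hσ

/-- The complexified heat symbol `ξ ↦ e^{-(2π)²σ‖ξ‖²}` is an `L^∞` function bounded by `1`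
(`σ ≥ 0`). [folklore] -/
theorem memLp_top_heatSymbol {σ : ℝ} (hσ : 0 ≤ σ) :
    MemLp (fun ξ : E => (heatSymbol σ ξ : ℂ)) ∞ (volume : Measure E) := by
  refine memLp_top_of_bound ?_ 1 (Eventually.of_forall fun ξ => ?_)
  · exact (UnboundedOperators.heatSymbol_hasTemperateGrowth_complex
      UnboundedOperators.heatSymbol_hasTemperateGrowth_holds hσ).1.continuous.aestronglyMeasurable
  · rw [Complex.norm_real, Real.norm_of_nonneg (UnboundedOperators.heatSymbol_pos σ ξ).le]
    exact UnboundedOperators.heatSymbol_le_one hσ ξ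

/-- **The heat semigroup on `L²` is the Fourier multiplier `e^{-(2π)²σ|ξ|²}`**, at the level of
`L²` classes: for `f ∈ L²(E; F)` and `σ > 0`, `𝓕(e^{σΔ}f) = Ĝ_σ • 𝓕f` in `L²`
(Stein–Weiss 1971, Ch. I, Thm. 1.18 with §3 (3.12): the Gauss–Weierstrass integral of an `L²`
function is the multiplier `e^{-4π²t|ξ|²}` on the Fourier side). Proof: both sides are `L²`
classes with the same tempered distribution — the tree's
`heatSemigroup_toTemperedDistribution_Lp_holds` (`e^{σΔ}` on `𝓢'` extends the kernel semigroup
on `L²`), Mathlib's `Lp.fourier_toTemperedDistribution_eq` (`𝓕` on `𝓢'` extends `𝓕` on `L²`)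
and `Lp.toTemperedDistribution_smul_eq` (distributional = pointwise product by the temperate
symbol) — and `L² → 𝓢'` is injective (`Lp.ker_toTemperedDistributionCLM_eq_bot`).
[cite: SteinWeiss1971, Ch. I Thm. 1.18 and §3 (3.12)] -/
theorem fourier_toLp_heatExtension_eq {f : E → F} (hf : MemLp f 2 (volume : Measure E)) {σ : ℝ}
    (hσ : 0 < σ) :
    (𝓕 ((memLp_two_heatExtension hf hσ).toLp (heatExtension f σ)) : Lp F 2 (volume : Measure E)) =
      (memLp_top_heatSymbol (E := E) hσ.le).toLp (fun ξ : E => (heatSymbol σ ξ : ℂ)) •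
        (𝓕 (hf.toLp f) : Lp F 2 (volume : Measure E)) := by
  have hG : Function.HasTemperateGrowth (fun ξ : E => (heatSymbol σ ξ : ℂ)) :=
    UnboundedOperators.heatSymbol_hasTemperateGrowth_complex
      UnboundedOperators.heatSymbol_hasTemperateGrowth_holds hσ.le
  -- injectivity of `L² → 𝓢'`
  have hinj := LinearMap.ker_eq_bot.1
    (Lp.ker_toTemperedDistributionCLM_eq_bot (F := F) (μ := (volume : Measure E)) (p := 2))
  apply hinj
  change Lp.toTemperedDistribution _ = Lp.toTemperedDistribution _
  rw [Lp.toTemperedDistribution_smul_eq hG (memLp_top_heatSymbol (E := E) hσ.le)]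
  change Lp.toTemperedDistribution (𝓕 _ : Lp F 2 (volume : Measure E)) =
    TemperedDistribution.smulLeftCLM F _ (Lp.toTemperedDistribution (𝓕 _ : Lp F 2 (volume : Measure E)))
  rw [← Lp.fourier_toTemperedDistribution_eq, ← Lp.fourier_toTemperedDistribution_eq]
  -- the heat semigroup on `𝓢'` extends the kernel semigroup on `L²`
  have hheat := Lp.heatSemigroup_toTemperedDistribution_Lp_holds (E := E) (F := F)
    UnboundedOperators.memLp_heatExtension_holds (p := 2) (hf.toLp f) hσ
  -- the heat extensions of `f` and of its `L²` representative coincide everywhere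
  have hrep : heatExtension ((hf.toLp f : Lp F 2 (volume : Measure E)) : E → F) σ =
      heatExtension f σ :=
    UnboundedOperators.heatExtension_congr_ae' hf.coeFn_toLp σ
  have hclass : ((Lp.memLp_heatExtension UnboundedOperators.memLp_heatExtension_holds
        (hf.toLp f) hσ).toLp _ : Lp F 2 (volume : Measure E)) =
      (memLp_two_heatExtension hf hσ).toLp (heatExtension f σ) := by
    refine Lp.ext ?_
    filter_upwards [MemLp.coeFn_toLp (Lp.memLp_heatExtension
      UnboundedOperators.memLp_heatExtension_holds (hf.toLp f) hσ),
      MemLp.coeFn_toLp (memLp_two_heatExtension hf hσ)] with x hx hx'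
    rw [hx, hx', hrep]
  rw [hclass] at hheat
  rw [← hheat, TemperedDistribution.heatSemigroup_eq_fourierMultiplierCLM,
    TemperedDistribution.fourierMultiplierCLM_apply, fourier_fourierInv_eq]

/-- **`𝓕(e^{σΔ}f) = e^{-(2π)²σ|ξ|²} 𝓕f` almost everywhere** for `f ∈ L²`, `σ > 0` (a.e. form of
`fourier_toLp_heatExtension_eq`; Stein–Weiss 1971, Ch. I Thm. 1.18).
[cite: SteinWeiss1971, Ch. I Thm. 1.18 and §3 (3.12)] -/
theorem fourier_toLp_heatExtension_ae_eq {f : E → F} (hf : MemLp f 2 (volume : Measure E))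
    {σ : ℝ} (hσ : 0 < σ) :
    ((𝓕 ((memLp_two_heatExtension hf hσ).toLp (heatExtension f σ)) : Lp F 2 (volume : Measure E))
        : E → F) =ᵐ[volume]
      fun ξ => (heatSymbol σ ξ : ℂ) • ((𝓕 (hf.toLp f) : Lp F 2 (volume : Measure E)) : E → F) ξ := by
  rw [fourier_toLp_heatExtension_eq hf hσ]
  filter_upwards [Lp.coeFn_lpSMul (r := 2)
      ((memLp_top_heatSymbol (E := E) hσ.le).toLp (fun ξ : E => (heatSymbol σ ξ : ℂ)))
      (𝓕 (hf.toLp f) : Lp F 2 (volume : Measure E)),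
    (memLp_top_heatSymbol (E := E) hσ.le).coeFn_toLp] with ξ hξ hξ'
  rw [hξ, Pi.smul_apply', hξ']

/-- The lower integral defining `‖e^{σΔ}f‖²_{Ḣ^s}` computed on the Fourier side:
`∫ ‖ξ‖^{2s} ‖𝓕(e^{σΔ}f)‖² = ∫ ‖ξ‖^{2s} Ĝ_σ(ξ)² ‖𝓕f(ξ)‖²` (`f ∈ L²`, `σ > 0`). [folklore] -/
theorem lintegral_hom_weight_fourier_heatExtension {f : E → F}
    (hf : MemLp f 2 (volume : Measure E)) {σ : ℝ} (hσ : 0 < σ) (s : ℝ) :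
    ∫⁻ ξ, ‖ξ‖ₑ ^ (2 * s) *
        ‖((𝓕 ((memLp_two_heatExtension hf hσ).toLp (heatExtension f σ)) :
            Lp F 2 (volume : Measure E)) : E → F) ξ‖ₑ ^ (2 : ℕ) =
      ∫⁻ ξ, ‖ξ‖ₑ ^ (2 * s) * (ENNReal.ofReal (heatSymbol σ ξ) ^ (2 : ℕ) *
        ‖((𝓕 (hf.toLp f) : Lp F 2 (volume : Measure E)) : E → F) ξ‖ₑ ^ (2 : ℕ)) := by
  refine lintegral_congr_ae ?_
  filter_upwards [fourier_toLp_heatExtension_ae_eq hf hσ] with ξ hξ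
  rw [hξ, enorm_smul, mul_pow, ← ofReal_norm (heatSymbol σ ξ : ℂ), Complex.norm_real,
    Real.norm_of_nonneg (UnboundedOperators.heatSymbol_pos σ ξ).le]

/-- **The heat semigroup contracts the `Ḣ^s` seminorm**: `‖e^{σΔ}f‖_{Ḣ^s} ≤ ‖f‖_{Ḣ^s}` for
every `f : E → F`, `σ > 0` and real `s` (the multiplier is bounded by `1`; Bahouri–Chemin–Danchin
2011, Lemma 2.4). [cite: BahouriCheminDanchin2011, Lemma 2.4] -/
theorem _root_.Function.eHomSobolevSeminorm_heatExtension_le (s : ℝ) (f : E → F) {σ : ℝ}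
    (hσ : 0 < σ) :
    Function.eHomSobolevSeminorm s (heatExtension f σ) ≤ Function.eHomSobolevSeminorm s f := by
  by_cases hf : MemLp f 2 (volume : Measure E)
  · rw [Function.eHomSobolevSeminorm_of_memLp (memLp_two_heatExtension hf hσ),
      Function.eHomSobolevSeminorm_of_memLp hf, eHomSobolevSeminorm, eHomSobolevSeminorm,
      lintegral_hom_weight_fourier_heatExtension hf hσ s]
    gcongr with ξ
    calc ENNReal.ofReal (heatSymbol σ ξ) ^ (2 : ℕ) *
          ‖((𝓕 (hf.toLp f) : Lp F 2 (volume : Measure E)) : E → F) ξ‖ₑ ^ (2 : ℕ)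
        ≤ 1 ^ (2 : ℕ) * ‖((𝓕 (hf.toLp f) : Lp F 2 (volume : Measure E)) : E → F) ξ‖ₑ ^ (2 : ℕ) := by
          gcongr
          exact ENNReal.ofReal_le_one.2 (UnboundedOperators.heatSymbol_le_one hσ.le ξ)
      _ = _ := by rw [one_pow, one_mul]
  · rw [Function.eHomSobolevSeminorm_of_not_memLp hf]
    exact le_top

omit [InnerProductSpace ℝ E] [FiniteDimensional ℝ E] [MeasurableSpace E] [BorelSpace E] in
/-- The elementary bound behind heat smoothing: for `0 ≤ s ≤ 1`, `σ > 0` and every `ξ`,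
`‖ξ‖^{2s} e^{-2(2π)²σ‖ξ‖²} ≤ (8π²σ)^{-s}` (with `x = 8π²σ‖ξ‖²`: `x^s e^{-x} ≤ max(1,x) e^{-x} ≤ 1`).
[folklore] -/
theorem hom_weight_mul_heatSymbol_sq_le {s : ℝ} (hs₀ : 0 ≤ s) (hs₁ : s ≤ 1) {σ : ℝ} (hσ : 0 < σ)
    (ξ : E) :
    ‖ξ‖ₑ ^ (2 * s) * ENNReal.ofReal (heatSymbol σ ξ) ^ (2 : ℕ) ≤
      ENNReal.ofReal ((8 * Real.pi ^ 2 * σ) ^ (-s)) := by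
  set c : ℝ := 8 * Real.pi ^ 2 * σ with hc
  have hcpos : 0 < c := by positivity
  set x : ℝ := c * ‖ξ‖ ^ 2 with hx
  have hx0 : 0 ≤ x := by positivity
  -- `heatSymbol σ ξ ^ 2 = exp (-x)`
  have hsymb : heatSymbol σ ξ ^ 2 = Real.exp (-x) := by
    rw [UnboundedOperators.heatSymbol, ← Real.exp_nat_mul]
    congr 1
    rw [hx, hc]
    push_cast
    ring
  -- `‖ξ‖^{2s} = c^{-s} x^s`
  have hnorm : ‖ξ‖ ^ (2 * s) = c ^ (-s) * x ^ s := by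
    rw [hx, Real.mul_rpow hcpos.le (sq_nonneg _), ← mul_assoc, Real.rpow_neg hcpos.le,
      inv_mul_cancel₀ (Real.rpow_pos_of_pos hcpos s).ne', one_mul, Real.rpow_mul (norm_nonneg _),
      Real.rpow_two]
  -- `x^s e^{-x} ≤ 1`
  have hkey : x ^ s * Real.exp (-x) ≤ 1 := by
    have h1 : x ^ s ≤ max 1 x := by
      rcases le_or_gt x 1 with hx1 | hx1
      · exact (Real.rpow_le_one hx0 hx1 hs₀).trans (le_max_left _ _)
      · calc x ^ s ≤ x ^ (1 : ℝ) := Real.rpow_le_rpow_of_exponent_le hx1.le hs₁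
          _ = x := Real.rpow_one x
          _ ≤ max 1 x := le_max_right _ _
    have h2 : max 1 x ≤ Real.exp x := max_le (Real.one_le_exp hx0) (by linarith [Real.add_one_le_exp x])
    rw [Real.exp_neg]
    rw [mul_inv_le_iff₀ (Real.exp_pos x), one_mul]
    exact h1.trans h2
  rw [← ofReal_norm, ENNReal.ofReal_rpow_of_nonneg (norm_nonneg _) (by positivity),
    ← ENNReal.ofReal_pow (UnboundedOperators.heatSymbol_pos σ ξ).le,
    ← ENNReal.ofReal_mul (by positivity), hsymb, hnorm, mul_assoc]
  refine ENNReal.ofReal_le_ofReal ?_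
  calc c ^ (-s) * (x ^ s * Real.exp (-x)) ≤ c ^ (-s) * 1 :=
        mul_le_mul_of_nonneg_left hkey (Real.rpow_nonneg hcpos.le _)
    _ = c ^ (-s) := mul_one _

/-- **`Ḣ^s` smoothing of the heat semigroup on `L²`** (Bahouri–Chemin–Danchin 2011, Lemma 2.4;
Lemarié-Rieusset 2016, proof of Thm. 7.4: `‖W_{νt} * f‖_{Ḣ^s} ≤ C (νt)^{-s/2} ‖f‖₂`): for `f ∈ L²`,
`σ > 0` and `0 ≤ s ≤ 1`, `‖e^{σΔ}f‖_{Ḣ^s} ≤ (8π²σ)^{-s/2} ‖f‖_{L²}`. (Plancherel and the pointwise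
bound `hom_weight_mul_heatSymbol_sq_le`; the restriction `s ≤ 1` only serves the explicit constant.)
[cite: BahouriCheminDanchin2011, Lemma 2.4] -/
theorem _root_.Function.eHomSobolevSeminorm_heatExtension_le_eLpNorm {f : E → F}
    (hf : MemLp f 2 (volume : Measure E)) {σ : ℝ} (hσ : 0 < σ) {s : ℝ} (hs₀ : 0 ≤ s) (hs₁ : s ≤ 1) :
    Function.eHomSobolevSeminorm s (heatExtension f σ) ≤
      ENNReal.ofReal ((8 * Real.pi ^ 2 * σ) ^ (-(s / 2))) * eLpNorm f 2 (volume : Measure E) := by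
  rw [Function.eHomSobolevSeminorm_of_memLp (memLp_two_heatExtension hf hσ), eHomSobolevSeminorm,
    lintegral_hom_weight_fourier_heatExtension hf hσ s]
  set G : E → F := ((𝓕 (hf.toLp f) : Lp F 2 (volume : Measure E)) : E → F) with hGdef
  have hbound : ∫⁻ ξ, ‖ξ‖ₑ ^ (2 * s) * (ENNReal.ofReal (heatSymbol σ ξ) ^ (2 : ℕ) * ‖G ξ‖ₑ ^ (2 : ℕ)) ≤
      ENNReal.ofReal ((8 * Real.pi ^ 2 * σ) ^ (-s)) * ∫⁻ ξ, ‖G ξ‖ₑ ^ (2 : ℕ) := by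
    rw [← lintegral_const_mul' _ _ ENNReal.ofReal_ne_top]
    refine lintegral_mono fun ξ => ?_
    rw [← mul_assoc]
    exact mul_le_mul' (hom_weight_mul_heatSymbol_sq_le hs₀ hs₁ hσ ξ) le_rfl
  -- Plancherel: `∫ ‖𝓕f‖² = ‖f‖₂²`
  have hplanch : (∫⁻ ξ, ‖G ξ‖ₑ ^ (2 : ℕ)) ^ (1 / 2 : ℝ) = eLpNorm f 2 (volume : Measure E) := by
    have h1 : eLpNorm G 2 (volume : Measure E) = (∫⁻ ξ, ‖G ξ‖ₑ ^ (2 : ℕ)) ^ (1 / 2 : ℝ) := by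
      rw [eLpNorm_eq_lintegral_rpow_enorm_toReal two_ne_zero ENNReal.ofNat_ne_top]
      simp only [ENNReal.toReal_ofNat, ENNReal.rpow_ofNat, one_div]
    rw [← h1, hGdef, ← Lp.enorm_def, ← ofReal_norm, Lp.norm_fourier_eq, ofReal_norm, Lp.enorm_def]
    exact eLpNorm_congr_ae hf.coeFn_toLp
  calc (∫⁻ ξ, ‖ξ‖ₑ ^ (2 * s) * (ENNReal.ofReal (heatSymbol σ ξ) ^ (2 : ℕ) * ‖G ξ‖ₑ ^ (2 : ℕ))) ^
        (1 / 2 : ℝ)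
      ≤ (ENNReal.ofReal ((8 * Real.pi ^ 2 * σ) ^ (-s)) * ∫⁻ ξ, ‖G ξ‖ₑ ^ (2 : ℕ)) ^ (1 / 2 : ℝ) := by
        gcongr
    _ = ENNReal.ofReal ((8 * Real.pi ^ 2 * σ) ^ (-(s / 2))) * eLpNorm f 2 (volume : Measure E) := by
        rw [ENNReal.mul_rpow_of_nonneg _ _ (by norm_num), hplanch,
          ENNReal.ofReal_rpow_of_nonneg (by positivity) (by norm_num), ← Real.rpow_mul (by positivity)]
        congr 3
        ring

/-- **`e^{σΔ}f ∈ Ḣ^s ∩ L²` for `f ∈ L²`, `σ > 0`, `0 ≤ s ≤ 1`** (heat smoothing,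
Bahouri–Chemin–Danchin 2011, Lemma 2.4). [cite: BahouriCheminDanchin2011, Lemma 2.4] -/
theorem memHomSobolev_heatExtension {f : E → F} (hf : MemLp f 2 (volume : Measure E)) {σ : ℝ}
    (hσ : 0 < σ) {s : ℝ} (hs₀ : 0 ≤ s) (hs₁ : s ≤ 1) : MemHomSobolev s (heatExtension f σ) := by
  rw [memHomSobolev_iff]
  refine ⟨memLp_two_heatExtension hf hσ,
    (Function.eHomSobolevSeminorm_heatExtension_le_eLpNorm hf hσ hs₀ hs₁).trans_lt ?_⟩
  exact ENNReal.mul_lt_top ENNReal.ofReal_lt_top hf.eLpNorm_lt_top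

/-- `Ḣ^s ∩ L²` is preserved by the heat semigroup (contraction of the seminorm). [folklore] -/
theorem MemHomSobolev.heatExtension {s : ℝ} {f : E → F} (hf : MemHomSobolev s f) {σ : ℝ}
    (hσ : 0 < σ) : MemHomSobolev s (heatExtension f σ) := by
  rw [memHomSobolev_iff] at hf ⊢
  exact ⟨memLp_two_heatExtension hf.1 hσ,
    (Function.eHomSobolevSeminorm_heatExtension_le s f hσ).trans_lt hf.2⟩

/-- **The heat extension commutes with the complexification of real vector fields**:
`complexify ∘ (e^{σΔ}a) = e^{σΔ}(complexify ∘ a)` for `a : E → ℝ^ι` (the kernel is real and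
`complexify` is a real-linear isometry, which passes through the Bochner integral). [folklore] -/
theorem EuclideanSpace.complexify_comp_heatExtension {ι : Type*} [Fintype ι]
    (a : E → _root_.EuclideanSpace ℝ ι) (σ : ℝ) :
    EuclideanSpace.complexify ∘ (heatExtension a σ) =
      heatExtension (EuclideanSpace.complexify ∘ a) σ := by
  funext x
  simp only [Function.comp_apply, UnboundedOperators.heatExtension_apply]
  rw [← (EuclideanSpace.complexify (ι := ι)).integral_comp_comm]
  refine integral_congr_ae (Eventually.of_forall fun y => ?_)
  simp only [LinearIsometry.map_smul]

end Heat

end Literature.Analysis.FunctionSpaces
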